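import Mathlib
import HarnessLib
import Summits.AtomisticToContinuum.FouriersLaw.Theses.JunctionLocality
import Literature.MathematicalPhysics.KineticTheory.LangevinChainKernel
import Literature.MathematicalPhysics.KineticTheory.LangevinChainGibbs

/-!
# Sketch — crux idea `forecast-sensitivity-selection` for `JunctionLocality.ConductanceLowerBound`
(stmt-AtomisticToContinuum-11749; ideator 3, generation 2, round 1)

The transport forecast `u_N(x) = E_x[∫₀^∞ J_tot dt]` of the equilibrium open chain, its contact
sensitivity `s_N = ∂_{p₀} u_N`, the exact identity `D_N = 2γ E_{μ_T}[s_N²] / (T (N−1))`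
(carré du champ of the two Ornstein–Uhlenbeck contacts + the Kundu–Dhar–Narayan open-chain Kubo
identity), the constraint-free SELECTION-RULE lower bound it implies, the crux of the line
(`ForecastInformedKicks`) and the composition to the route decl.
-/

noncomputable section

open MeasureTheory Filter Topology Set
open scoped NNReal ENNReal

namespace Summit.AtomisticToContinuum.FouriersLaw.Cruxes.ConductanceLowerBound.ForecastSensitivity

open Literature.MathematicalPhysics.KineticTheory.HeatConduction

variable (P : OscillatorChain)

/-- Total (bond-summed) energy current `J_tot = Σ_i j_i`. -/
def totalJ (N : ℕ) (x : PhaseSpace N) : ℝ := ∑ i : Fin N, P.bondCurrent N i x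

/-- Finite-horizon transport forecast `ψ_τ(x) = E_x[∫₀^τ J_tot(X_s) ds] = ∫₀^τ (P_s J_tot)(x) ds`
(equilibrium open chain: both baths at `T`; constructed kernels `transitionKernel`). -/
def forecastH (N : ℕ) (T τ : ℝ) (x : PhaseSpace N) : ℝ :=
  ∫ s in (0 : ℝ)..τ, (∫ y, totalJ P N y ∂(P.transitionKernel N T T (Real.toNNReal s) x))

/-- Transport forecast `u_N(x) = E_x[∫₀^∞ J_tot dt] = ((−L_N)⁻¹ J_tot)(x)` as an improper time
integral (its convergence at fixed `N` is part of the support item below). -/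
def transportForecast (N : ℕ) (T : ℝ) (x : PhaseSpace N) : ℝ :=
  ∫ s in Ioi (0 : ℝ), (∫ y, totalJ P N y ∂(P.transitionKernel N T T (Real.toNNReal s) x))

/-- Contact sensitivity `s_N = ∂_{p₀} u_N` at the left bath site (`N = n + 2`). -/
def contactSensitivity (n : ℕ) (T : ℝ) (x : PhaseSpace (n + 2)) : ℝ :=
  partialP (0 : Fin (n + 2)) (transportForecast P (n + 2) T) x

/-- A selection rule `φ` does not read the left contact momentum `p₀`. -/
def IsContactFree {n : ℕ} (φ : PhaseSpace (n + 2) → ℝ) : Prop :=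
  ∀ (x : PhaseSpace (n + 2)) (t : ℝ), φ (x.1, Function.update x.2 0 t) = φ x

/-- Kick response of the selection rule `φ` (any `φ`; for contact-free `φ` the second term drops):
`𝓡_N(φ) = ∫₀^∞ E_{μ_T}[(p₀ φ − T ∂_{p₀}φ)(X₀) · J_tot(X_t)] dt = T · E_{μ_T}[φ · ∂_{p₀} u_N]`
(Gibbs integration by parts in the Maxwellian contact momentum) = first-order total transport
caused by an impulsive kick of the left contact momentum of strength `∝ φ(x)`. -/
def kickResponse (n : ℕ) (T : ℝ) (φ : PhaseSpace (n + 2) → ℝ) : ℝ :=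
  ∫ t in Ioi (0 : ℝ), ∫ x, (x.2 0 * φ x - T * partialP (0 : Fin (n + 2)) φ x) *
      (∫ y, totalJ P (n + 2) y ∂(P.transitionKernel (n + 2) T T (Real.toNNReal t) x))
    ∂(P.gibbsMeasure (n + 2) T)

/-- Contact-to-contact form of the kick response (equal to `kickResponse` by the fixed-`N` identity
`(−L)⁻¹ j_i = −Ẽ_{>i} + (−L)⁻¹ w_R`, `w_R = γ(p²_{N−1} − T)`, the static term vanishing because
`E_{>i}` does not read `p₀`): `(N−1) · γ ∫₀^∞ E[(p₀φ − T∂_{p₀}φ)(X₀) · (p²_{N−1}(X_t) − T)] dt` —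
"(N−1) × the heat an informed left kick sends into the FAR bath". -/
def farKickResponse (n : ℕ) (T : ℝ) (φ : PhaseSpace (n + 2) → ℝ) : ℝ :=
  ((n : ℝ) + 1) * P.γ * ∫ t in Ioi (0 : ℝ), ∫ x, (x.2 0 * φ x - T * partialP (0 : Fin (n + 2)) φ x) *
      (∫ y, ((y.2 (Fin.last (n + 1))) ^ 2 - T) ∂(P.transitionKernel (n + 2) T T (Real.toNNReal t) x))
    ∂(P.gibbsMeasure (n + 2) T)

/-- SUPPORT (theorem-grade modulo the open-chain Kubo identity): inside the crux frame, the response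
coefficient is the bath-smoothed contact sensitivity of the transport forecast,
`D_{n+2} = 2γ · E_{μ_T}[s_{n+2}²] / (T (n+1))`
(KDN `(N−1)T²D_N = ∫₀^∞⟨J_tot, P_tJ_tot⟩ = ⟨u,(−L)u⟩ = ⟨u,(−S)u⟩ = γT Σ_b E[(∂_{p_b}u)²]`, the two
contacts equal by reflection). -/
def ContactSensitivityIdentity : Prop :=
  ∀ ω₂ lam β γ : ℝ, 0 < ω₂ → 0 < lam → 0 < β → 0 < γ →
    (∀ (N : ℕ) (T_L T_R : ℝ), 0 < T_L → 0 < T_R → ∀ μ ν : Measure (PhaseSpace N),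
      (pinnedChain ω₂ lam β γ).IsSteadyState N T_L T_R μ →
      (pinnedChain ω₂ lam β γ).IsSteadyState N T_L T_R ν → μ = ν) →
    ∀ μ : (N : ℕ) → ℝ → ℝ → Measure (PhaseSpace N),
      (∀ (N : ℕ) (T_L T_R : ℝ), 0 < T_L → 0 < T_R →
        (pinnedChain ω₂ lam β γ).IsSteadyState N T_L T_R (μ N T_L T_R)) →
      ∀ T : ℝ, 0 < T → ∀ D : ℕ → ℝ,
        (∀ N : ℕ, Tendsto (fun δ : ℝ =>
          (pinnedChain ω₂ lam β γ).totalCurrent (μ N (T + δ / 2) (T - δ / 2)) / δ)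
          (𝓝[≠] 0) (𝓝 (D N))) →
        ∀ n : ℕ, D (n + 2) = 2 * γ / (T * ((n : ℝ) + 1)) *
          ∫ x, (contactSensitivity (pinnedChain ω₂ lam β γ) n T x) ^ 2
            ∂((pinnedChain ω₂ lam β γ).gibbsMeasure (n + 2) T)

/-- SUPPORT (Cauchy–Schwarz in the contact Dirichlet form + Gibbs integration by parts; provable from
`ContactSensitivityIdentity`): the SELECTION-RULE LOWER BOUND — for every `C¹` rule `φ ∈ L²(μ_T)`,
`D_{n+2} ≥ 2γ 𝓡(φ)² / (T³ (n+1) ‖φ‖²)`. Constraint-free: every `φ` gives a rigorous bound; equality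
at `φ ∝ ∂_{p₀} u_N`, so the bound is an exact variational principle for `D_N`. -/
def SelectionRuleBound : Prop :=
  ∀ ω₂ lam β γ : ℝ, 0 < ω₂ → 0 < lam → 0 < β → 0 < γ →
    (∀ (N : ℕ) (T_L T_R : ℝ), 0 < T_L → 0 < T_R → ∀ μ ν : Measure (PhaseSpace N),
      (pinnedChain ω₂ lam β γ).IsSteadyState N T_L T_R μ →
      (pinnedChain ω₂ lam β γ).IsSteadyState N T_L T_R ν → μ = ν) →
    ∀ μ : (N : ℕ) → ℝ → ℝ → Measure (PhaseSpace N),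
      (∀ (N : ℕ) (T_L T_R : ℝ), 0 < T_L → 0 < T_R →
        (pinnedChain ω₂ lam β γ).IsSteadyState N T_L T_R (μ N T_L T_R)) →
      ∀ T : ℝ, 0 < T → ∀ D : ℕ → ℝ,
        (∀ N : ℕ, Tendsto (fun δ : ℝ =>
          (pinnedChain ω₂ lam β γ).totalCurrent (μ N (T + δ / 2) (T - δ / 2)) / δ)
          (𝓝[≠] 0) (𝓝 (D N))) →
        ∀ (n : ℕ) (φ : PhaseSpace (n + 2) → ℝ),
          MemLp φ 2 ((pinnedChain ω₂ lam β γ).gibbsMeasure (n + 2) T) →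
          ContDiff ℝ 1 φ →
          0 < ∫ x, φ x ^ 2 ∂((pinnedChain ω₂ lam β γ).gibbsMeasure (n + 2) T) →
          2 * γ * (kickResponse (pinnedChain ω₂ lam β γ) n T φ) ^ 2 /
              (T ^ 3 * ((n : ℝ) + 1) * ∫ x, φ x ^ 2 ∂((pinnedChain ω₂ lam β γ).gibbsMeasure (n + 2) T))
            ≤ D (n + 2)

/-- THE CRUX OF THE LINE — FORECAST-INFORMED KICKS: at every admissible parameter point and `T > 0`
there are selection rules `φ_N` whose kick response beats their `L²` size by `√N`:
`𝓡_N(φ_N)² ≥ c · (N−1) · ‖φ_N‖²` eventually in `N` (an equilibrium, `N`-by-`N` statement about ONE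
designed time-integrated cross-correlation per `N`; unselective, local and energy-profile rules give
only `O(‖φ‖²)`). -/
def ForecastInformedKicks : Prop :=
  ∀ ω₂ lam β γ : ℝ, 0 < ω₂ → 0 < lam → 0 < β → 0 < γ → ∀ T : ℝ, 0 < T →
    ∃ c : ℝ, 0 < c ∧ ∀ᶠ n : ℕ in atTop, ∃ φ : PhaseSpace (n + 2) → ℝ,
      MemLp φ 2 ((pinnedChain ω₂ lam β γ).gibbsMeasure (n + 2) T) ∧ ContDiff ℝ 1 φ ∧
      0 < ∫ x, φ x ^ 2 ∂((pinnedChain ω₂ lam β γ).gibbsMeasure (n + 2) T) ∧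
      c * ((n : ℝ) + 1) * ∫ x, φ x ^ 2 ∂((pinnedChain ω₂ lam β γ).gibbsMeasure (n + 2) T)
        ≤ (kickResponse (pinnedChain ω₂ lam β γ) n T φ) ^ 2

/-- COMPOSITION (real arithmetic): the selection-rule bound and forecast-informed kicks give the crux,
with `c_crux = 2γc/T³` and `N₁` from the eventuality. -/
theorem conductanceLowerBound_of_forecastInformedKicks
    (hS : SelectionRuleBound) (hF : ForecastInformedKicks) :
    Summit.AtomisticToContinuum.FouriersLaw.Theses.JunctionLocality.ConductanceLowerBound := by
  intro ω₂ lam β γ hω hl hβ hγ huniq μ hμ T hT D hD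
  obtain ⟨c, hc, hev⟩ := hF ω₂ lam β γ hω hl hβ hγ T hT
  obtain ⟨n₀, hn₀⟩ := eventually_atTop.mp hev
  refine ⟨2 * γ * c / T ^ 3, by positivity, n₀ + 2, fun N hN => ?_⟩
  obtain ⟨n, rfl⟩ : ∃ n, N = n + 2 := ⟨N - 2, by omega⟩
  obtain ⟨φ, hL2, hφ, hpos, hkick⟩ := hn₀ n (by omega)
  have hbound := hS ω₂ lam β γ hω hl hβ hγ huniq μ hμ T hT D hD n φ hL2 hφ hpos
  set I : ℝ := ∫ x, φ x ^ 2 ∂((pinnedChain ω₂ lam β γ).gibbsMeasure (n + 2) T) with hI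
  set R : ℝ := kickResponse (pinnedChain ω₂ lam β γ) n T φ with hR
  have hn1 : (0 : ℝ) < (n : ℝ) + 1 := by positivity
  have hT3 : (0 : ℝ) < T ^ 3 := by positivity
  have hden : 0 < T ^ 3 * ((n : ℝ) + 1) * I := by positivity
  -- 2γc/T³ ≤ 2γ R²/(T³ (n+1) I) ≤ D (n+2)
  calc 2 * γ * c / T ^ 3 = 2 * γ * (c * ((n : ℝ) + 1) * I) / (T ^ 3 * ((n : ℝ) + 1) * I) := by
          field_simp
    _ ≤ 2 * γ * R ^ 2 / (T ^ 3 * ((n : ℝ) + 1) * I) := by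
          apply div_le_div_of_nonneg_right _ hden.le
          exact mul_le_mul_of_nonneg_left hkick (by positivity)
    _ ≤ D (n + 2) := hbound

end Summit.AtomisticToContinuum.FouriersLaw.Cruxes.ConductanceLowerBound.ForecastSensitivity

end
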